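import Summits.AtomisticToContinuum.HydrodynamicLimit.Theses.OneFlightGossipEngine
import Literature.MathematicalPhysics.KineticTheory.CollisionFluxUpperBound
import Literature.MathematicalPhysics.KineticTheory.HardSphereCanonicalPairBound
import Summits.AtomisticToContinuum.HydrodynamicLimit.Theorems.JParityClosureOddContactSymmetryGibbsInvariance
import Summits.AtomisticToContinuum.HydrodynamicLimit.Theorems.JParityClosureCollisionTightnessSweptTube
import Summits.AtomisticToContinuum.HydrodynamicLimit.Theorems.JParityClosureCollisionTightnessTorusGibbs
import Literature.Analysis.FluidPDE.HardSphereCollisionRecord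
import HarnessLib

/-!
# Crux `EnergyCurrentTails` (stmt-AtomisticToContinuum-9235), line `quartic-schur-ledger`:
# the window GAIN CEILING (stub S2 `stub_gainCeiling`) at RUNG 0 — a certificate

Helper file (`--supports stmt-AtomisticToContinuum-9235`).  Stub S2 of the registered skeleton asks,
under the EVOLVED local Gibbs law, for a sub-linear ceiling `Gain_N(s,s′] ≤ D + η · sup y_N` on the
expected normalised quartic collision GAIN `∫ (N+1)⁻¹ Σ_{ordered collision records in (s,s′]} (Δ₄)₊/2 dλ_N`
of one window `s′ ≤ s + h_N = s + τ (N+1)^{-1/3}`, `Δ₄ = ‖v₁⁺‖⁴ + ‖v₂⁺‖⁴ − ‖v₁⁻‖⁴ − ‖v₂⁻‖⁴`; for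
non-constant profiles this needs an `N`-uniform bound on the energy-weighted collision flux under a
NON-invariant law, which no tool of the tree supplies.  This file proves the RUNG-0 instance (constant
profiles: the homogeneous Gibbs law `G_N`, invariant under every hard-sphere flow,
`measurePreserving_flow_localGibbsLaw_const`) with the `η`-term UNUSED and `D = 16 τ σ² I` independent
of `N ≥ 1` and of the window position (`stub_gainCeilingRung0`, registered audit stub; the literal body
of S2 at constant profiles follows by `le_self_add`): per collision
`(Δ₄)₊/2 ≤ (‖v₁⁺‖² + ‖v₂⁺‖²)²/4 =: b(v₁⁺, v₂⁺)` (pair energy conserved; `quarticGain_le_of_sq_eq`);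
PATHWISE on the good set the window gain is at most the collision pair sum of `b` over `[0, h_N]` along
the orbit of `Φ_s z` (`ofReal_gainSum_le_collisionPairSum`, group property); the window bound
`measure_collisionSum_ge_le_liminf` of `Literature/…/CollisionFluxUpperBound` in EXPECTATION form
(`lintegral_le_liminf_of_le_collisionPairSum`: pathwise grid majorant, Fatou, stationarity — the Markov
step dropped, `∫ K⋆ ∘ Φ_{t₀} = ∫ K⋆` added; no measurability of the collision sum needed) and its
rung-0 specialisation by the one-window statics `exists_windowEvent`
(`localGibbsLaw_lintegral_le_of_le_collisionMarkSum`: `∫ f dG_N ≤ 16 τ (N+1)² ε² ∫ ‖w − v‖ A dN^{⊗2}`);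
`I = ∫ ‖w − v‖ b dN(u,θ̄)^{⊗2} < ∞` (`lintegral_fluxQuartic_ne_top`, `≤ ‖v‖⁵ + ‖w‖⁵`, Fernique); and
`(N+1)⁻¹ · 16 h_N (N+1)² ε_N² = 16 τ σ²` (`ε_N = σ (N+1)^{-1/3}`): the mean window gain is `O(1)` in
`N` — S2 is consistent at equilibrium with the slope unused (`σ < σ₀`, the small reduced density of
`posGibbs_pairEvent_le`; `N ≥ 1` for the pair bound).

References: C. Cercignani, R. Illner, M. Pulvirenti, *The Mathematical Theory of Dilute Gases* (1994),
App. 4.A; I. Gallagher, L. Saint-Raymond, B. Texier, *From Newton to Boltzmann* (2013), Prop. 4.1.1.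
-/

noncomputable section

open MeasureTheory Set Filter Topology
open scoped ENNReal InnerProductSpace BigOperators

namespace Summit.AtomisticToContinuum.HydrodynamicLimit.Theorems.QuarticSchurLedger

open Literature.MathematicalPhysics.KineticTheory Literature.Analysis.FluidPDE
open Literature.Analysis.FunctionSpaces

/-! ### The window bound in expectation form -/

/-- **The window bound for collision sums under a flow-invariant law — expectation form.**  In the
setting of `measure_collisionSum_ge_le_liminf` (law `P` preserved by every `Φ_t` and carried by the good
set, `τ > 0`, an arbitrary `ℝ≥0∞`-valued mark `F(w, i, j)`, measurable one-window events `E M i j` and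
majorants `F̃ M` along backward free flights of duration `≤ τ/M`), every `f` dominated on the good set
by the collision pair sum of `F` over `[0, τ]` ALONG THE ORBIT OF `Φ_{t₀} z` has
`∫ f dP ≤ liminf_M M · ∫ Σ_{i≠j} 𝟙_{E M i j} F̃ M(·,i,j) dP` (grid majorant, Fatou, stationarity). [folklore] -/
theorem lintegral_le_liminf_of_le_collisionPairSum {d X : Type*} [Fintype d] [MeasureSpace X]
    [TopologicalSpace X] {G : Geometry d X} {ε : ℝ} {n : ℕ} (Φ : HardSphereFlow G ε n)
    (P : Measure (Config n d X)) (hstat : ∀ t : ℝ, MeasurePreserving (Φ.flow t) P P)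
    (hgood : ∀ᵐ z ∂P, z ∈ Φ.good) {τ : ℝ} (hτ : 0 < τ)
    (F : Config n d X → Fin n → Fin n → ℝ≥0∞) (E : ℕ → Fin n → Fin n → Set (Config n d X))
    (hEm : ∀ M i j, MeasurableSet (E M i j))
    (hE : ∀ (M : ℕ) (i j : Fin n), i ≠ j → ∀ w ∈ hardSphereDomain G n ε, ∀ t ∈ Icc 0 (τ / M),
      ‖G.sepVec ((freeFlight G (-t) w i).1) ((freeFlight G (-t) w j).1)‖ = ε → w ∈ E M i j)
    (Ft : ℕ → Config n d X → Fin n → Fin n → ℝ≥0∞) (hFtm : ∀ M i j, Measurable fun w => Ft M w i j)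
    (hFt : ∀ (M : ℕ) (i j : Fin n), i ≠ j → ∀ w ∈ hardSphereDomain G n ε, ∀ t ∈ Icc 0 (τ / M),
      ‖G.sepVec ((freeFlight G (-t) w i).1) ((freeFlight G (-t) w j).1)‖ = ε →
        F (freeFlight G (-t) w) i j ≤ Ft M w i j)
    (t₀ : ℝ) {f : Config n d X → ℝ≥0∞}
    (hf : ∀ z ∈ Φ.good, f z ≤ Φ.collisionPairSum (Icc 0 τ) (fun _ w i j => F w i j) (Φ.flow t₀ z)) :
    ∫⁻ z, f z ∂P ≤ liminf (fun M : ℕ => (M : ℝ≥0∞) *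
        ∫⁻ w, ∑ i, ∑ j, (if i ≠ j then (E M i j).indicator (fun w => Ft M w i j) w else 0) ∂P)
      atTop := by
  classical
  -- the one-window functional, the grid sums and their measurable `liminf`
  set W : ℕ → Config n d X → ℝ≥0∞ := fun M w => ∑ i, ∑ j,
    (if i ≠ j then (E M i j).indicator (fun w => Ft M w i j) w else 0) with hWdef
  have hWm : ∀ M, Measurable (W M) := fun M =>
    Finset.measurable_sum _ fun i _ => Finset.measurable_sum _ fun j _ => by
      split_ifs; exacts [(hFtm M i j).indicator (hEm M i j), measurable_const]
  set SM : ℕ → Config n d X → ℝ≥0∞ := fun M z =>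
    ∑ k ∈ Finset.Icc 1 M, W M (Φ.flow ((k : ℝ) * (τ / M)) z) with hSMdef
  have hSMm : ∀ M, Measurable (SM M) := fun M =>
    Finset.measurable_sum _ fun k _ => (hWm M).comp (Φ.measurable_flow _)
  set Kstar : Config n d X → ℝ≥0∞ := fun z => liminf (fun M => SM M z) atTop with hKdef
  have hKm : Measurable Kstar := Measurable.liminf hSMm
  -- (i) the pathwise bound on the good set
  have hpath : ∀ w ∈ Φ.good, Φ.collisionPairSum (Icc 0 τ) (fun _ w i j => F w i j) w ≤ Kstar w := by
    intro w hw
    have hγ := Φ.isTrajectory w hw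
    have hfin := hγ.locFinite 0 τ
    rw [Φ.collisionPairSum_eq_finsum_ite hw, finsum_mem_eq_finite_toFinset_sum _ hfin]
    obtain ⟨g, hg, hgap⟩ := exists_gap_of_finite hfin
    show _ ≤ liminf (fun M => SM M w) atTop
    refine le_liminf_of_le (h := ?_)
    filter_upwards [eventually_gt_atTop ⌈τ / g⌉₊] with M hM
    have hM0 : 0 < M := lt_of_le_of_lt (Nat.zero_le _) hM
    have hMg : τ / M < g := by
      have h1 : τ / g < M := (Nat.le_ceil _).trans_lt (by exact_mod_cast hM)
      rw [div_lt_iff₀ hg] at h1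
      rw [div_lt_iff₀ (by exact_mod_cast hM0)]
      linarith
    have hgap' : ∀ s ∈ collisionTimes G ε (fun t => Φ.flow t w) ∩ Icc 0 τ,
        ∀ s' ∈ collisionTimes G ε (fun t => Φ.flow t w) ∩ Icc 0 τ, s < s' → τ / M < s' - s :=
      fun s hs s' hs' hlt => hMg.trans_le (hgap s hs s' hs' hlt)
    exact sum_collision_le_sum_window hγ hτ hM0 hgap' (E M) (hE M) F (Ft M) (hFt M)
  -- (ii) the mean of each grid sum (stationarity) and Fatou
  have hmeanM : ∀ M, ∫⁻ z, SM M z ∂P = (M : ℝ≥0∞) * ∫⁻ w, W M w ∂P := by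
    intro M
    calc ∫⁻ z, SM M z ∂P = ∑ k ∈ Finset.Icc 1 M, ∫⁻ z, W M (Φ.flow ((k : ℝ) * (τ / M)) z) ∂P :=
          lintegral_finsetSum _ fun k _ => (hWm M).comp (Φ.measurable_flow _)
      _ = ∑ _k ∈ Finset.Icc 1 M, ∫⁻ z, W M z ∂P :=
          Finset.sum_congr rfl fun k _ => (hstat _).lintegral_comp (hWm M)
      _ = (M : ℝ≥0∞) * ∫⁻ w, W M w ∂P := by
          rw [Finset.sum_const, Nat.card_Icc, Nat.add_sub_cancel, nsmul_eq_mul]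
  have hmean : ∫⁻ z, Kstar z ∂P ≤ liminf (fun M : ℕ => (M : ℝ≥0∞) * ∫⁻ w, W M w ∂P) atTop := by
    refine (lintegral_liminf_le hSMm).trans (le_of_eq ?_)
    exact congrArg (fun u : ℕ → ℝ≥0∞ => liminf u atTop) (funext hmeanM)
  -- (iii) a.e. domination by `K⋆ ∘ Φ_{t₀}` and stationarity once more
  have hae : ∀ᵐ z ∂P, f z ≤ Kstar (Φ.flow t₀ z) := by
    filter_upwards [hgood] with z hz
    exact (hf z hz).trans (hpath _ (Φ.mapsTo_good t₀ hz))
  calc ∫⁻ z, f z ∂P ≤ ∫⁻ z, Kstar (Φ.flow t₀ z) ∂P := lintegral_mono_ae hae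
    _ = ∫⁻ z, Kstar z ∂P := (hstat t₀).lintegral_comp hKm
    _ ≤ _ := hmean

/-- **Rung-0 collision-flux bound in expectation form.**  For `σ ≤ 1/2`, constant profiles `a, θ > 0`,
`u`, a flow `Φ` of `N + 1` spheres of diameter `ε = hsDiameter σ N` preserving the homogeneous Gibbs law
`G_N` (`hstat`), the pair bound `hpair`, swept tubes `htube` and the lift inequality `hlift` of
`localGibbsLaw_collisionMarkSum_ge_le`, `τ > 0` and a measurable `ℝ≥0∞`-valued mark `A` of two
velocities: every `f` dominated on the good set by the collision pair sum of `A(vᵢ, vⱼ)` over `[0, τ]`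
along the orbit of `Φ_{t₀} z` has `∫ f dG_N ≤ 16 τ (N+1)² ε² · ∫ ‖w − v‖ A(v, w) dN(u,θ)^{⊗2}`
(Cercignani–Illner–Pulvirenti 1994, App. 4.A). [folklore] -/
theorem localGibbsLaw_lintegral_le_of_le_collisionMarkSum {σ : ℝ} (hσ2 : σ ≤ 1 / 2) {a θ : ℝ}
    (ha : 0 < a) (hθ : 0 < θ) (u : V3) {N : ℕ}
    (Φ : HardSphereFlow (Torus.geometry (Fin 3)) (hsDiameter σ N) (N + 1))
    (hstat : ∀ t : ℝ, MeasurePreserving (Φ.flow t)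
      (localGibbsLaw σ (fun _ => a) (fun _ => u) (fun _ => θ) N Φ)
      (localGibbsLaw σ (fun _ => a) (fun _ => u) (fun _ => θ) N Φ))
    (hpair : ∀ i j : Fin (N + 1), i ≠ j → ∀ T : Set T3, MeasurableSet T →
      posGibbsMeasure (fun _ : T3 => (1 : ℝ)) (hsDiameter σ N) (N + 1) {x | x i - x j ∈ T} ≤
        4 * volume T)
    (htube : ∀ h : ℝ, 0 ≤ h → ∃ S : V3 → Set V3, MeasurableSet {q : V3 × V3 | q.1 ∈ S q.2} ∧
      (∀ u, volume (S u) ≤ ENNReal.ofReal (4 * hsDiameter σ N ^ 2 * h * ‖u‖)) ∧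
      ∀ (u r : V3) (s : ℝ), hsDiameter σ N ≤ ‖r‖ → s ∈ Icc 0 h → ‖r + s • u‖ = hsDiameter σ N →
        r ∈ S u)
    (hlift : ∀ B : Set V3, MeasurableSet B →
      volume {x : T3 | ∃ k : Fin 3 → ℤ, Torus.reprSym x + Torus.latticeVec k ∈ B} ≤ volume B)
    {τ : ℝ} (hτ : 0 < τ) {A : V3 × V3 → ℝ≥0∞} (hAm : Measurable A) (t₀ : ℝ)
    {f : Config (N + 1) (Fin 3) T3 → ℝ≥0∞}
    (hf : ∀ z ∈ Φ.good,
      f z ≤ Φ.collisionPairSum (Icc 0 τ) (fun _ w i j => A ((w i).2, (w j).2)) (Φ.flow t₀ z)) :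
    ∫⁻ z, f z ∂(localGibbsLaw σ (fun _ => a) (fun _ => u) (fun _ => θ) N Φ) ≤
      ENNReal.ofReal (16 * τ * ((N + 1 : ℕ) : ℝ) ^ 2 * hsDiameter σ N ^ 2) *
        ∫⁻ p, ENNReal.ofReal ‖p.2 - p.1‖ * A p ∂((gaussMeasure u θ).prod (gaussMeasure u θ)) := by
  classical
  set P := localGibbsLaw σ (fun _ => a) (fun _ => u) (fun _ => θ) N Φ with hPdef
  set I : ℝ≥0∞ := ∫⁻ p, ENNReal.ofReal ‖p.2 - p.1‖ * A p ∂((gaussMeasure u θ).prod (gaussMeasure u θ))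
    with hIdef
  -- the mark as a function of the configuration (unchanged along free flight)
  set F : Config (N + 1) (Fin 3) T3 → Fin (N + 1) → Fin (N + 1) → ℝ≥0∞ :=
    fun w i j => A ((w i).2, (w j).2) with hFdef
  have hFm : ∀ i j, Measurable fun w => F w i j :=
    fun i j => hAm.comp ((measurable_pi_apply i).snd.prodMk (measurable_pi_apply j).snd)
  -- the window events, for every mesh `τ / M` and every ordered pair
  have hev : ∀ (M : ℕ) (i j : Fin (N + 1)), ∃ E : Set (Config (N + 1) (Fin 3) T3), MeasurableSet E ∧
      (i ≠ j → ∀ w ∈ hardSphereDomain (Torus.geometry (Fin 3)) (N + 1) (hsDiameter σ N),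
        ∀ t ∈ Icc 0 (τ / M),
        ‖(Torus.geometry (Fin 3)).sepVec ((freeFlight (Torus.geometry (Fin 3)) (-t) w i).1)
          ((freeFlight (Torus.geometry (Fin 3)) (-t) w j).1)‖ = hsDiameter σ N → w ∈ E) ∧
      (i ≠ j → ∫⁻ w, E.indicator (fun w => F w i j) w ∂P ≤
        ENNReal.ofReal (16 * hsDiameter σ N ^ 2 * (τ / M)) * I) := by
    intro M i j
    by_cases hij : i ≠ j
    · have hh : 0 ≤ τ / M := div_nonneg hτ.le (Nat.cast_nonneg M)
      obtain ⟨S, hSm, hSvol, hS⟩ := htube (τ / M) hh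
      obtain ⟨E, hEm, hEc, hEb⟩ :=
        exists_windowEvent hσ2 ha hθ u hh hij (hpair i j hij) hSm hSvol hS hlift
      exact ⟨E, hEm, fun _ => hEc, fun _ => hEb Φ A hAm⟩
    · exact ⟨∅, MeasurableSet.empty, fun h => absurd h hij, fun h => absurd h hij⟩
  choose E hEm hEc hEb using hev
  -- the general window bound in expectation form
  have hgood : ∀ᵐ z ∂P, z ∈ Φ.good := by
    refine mem_ae_iff.2 ?_
    rw [hPdef, localGibbsLaw_eq]
    exact localGibbsMeasure_absolutelyContinuous σ _ _ _ N Φ Φ.measure_compl_good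
  have hgen := lintegral_le_liminf_of_le_collisionPairSum Φ P hstat hgood hτ F (fun M i j => E M i j)
    hEm (fun M i j hij => hEc M i j hij) (fun _ => F) (fun _ i j => hFm i j)
    (fun M i j _ w _ t _ _ => by simp only [hFdef, freeFlight_apply, le_refl]) t₀ hf
  -- the mean of one window: the static bound, `(N+1)²` ordered pairs, and `M · (τ/M) = τ`
  have hB : ∀ M : ℕ, (M : ℝ≥0∞) * ∫⁻ w, ∑ i, ∑ j,
      (if i ≠ j then (E M i j).indicator (fun w => F w i j) w else 0) ∂P ≤
        ENNReal.ofReal (16 * τ * ((N + 1 : ℕ) : ℝ) ^ 2 * hsDiameter σ N ^ 2) * I := by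
    intro M
    rcases Nat.eq_zero_or_pos M with hM0 | hM0
    · subst hM0
      simp only [Nat.cast_zero, zero_mul, zero_le]
    have hM' : (0 : ℝ) < M := by exact_mod_cast hM0
    have hterm : ∀ i j : Fin (N + 1), ∫⁻ w, (if i ≠ j then (E M i j).indicator
        (fun w => F w i j) w else 0) ∂P ≤ ENNReal.ofReal (16 * hsDiameter σ N ^ 2 * (τ / M)) * I :=
      fun i j => by split_ifs with hij; exacts [hEb M i j hij, by simp only [lintegral_zero, zero_le]]
    have hmeas : ∀ i j : Fin (N + 1), Measurable fun w : Config (N + 1) (Fin 3) T3 =>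
        (if i ≠ j then (E M i j).indicator (fun w => F w i j) w else 0) :=
      fun i j => by split_ifs; exacts [(hFm i j).indicator (hEm M i j), measurable_const]
    calc (M : ℝ≥0∞) * ∫⁻ w, ∑ i, ∑ j,
          (if i ≠ j then (E M i j).indicator (fun w => F w i j) w else 0) ∂P
        = (M : ℝ≥0∞) * ∑ i, ∑ j, ∫⁻ w,
            (if i ≠ j then (E M i j).indicator (fun w => F w i j) w else 0) ∂P := by
          congr 1
          rw [lintegral_finsetSum _ fun i _ => Finset.measurable_sum _ fun j _ => hmeas i j]
          exact Finset.sum_congr rfl fun i _ => lintegral_finsetSum _ fun j _ => hmeas i j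
      _ ≤ (M : ℝ≥0∞) * ∑ _i : Fin (N + 1), ∑ _j : Fin (N + 1),
            ENNReal.ofReal (16 * hsDiameter σ N ^ 2 * (τ / M)) * I := by
          gcongr with i _ j _
          exact hterm i j
      _ = ENNReal.ofReal (16 * τ * ((N + 1 : ℕ) : ℝ) ^ 2 * hsDiameter σ N ^ 2) * I := by
          simp only [Finset.sum_const, Finset.card_univ, Fintype.card_fin, nsmul_eq_mul]
          rw [← ENNReal.ofReal_natCast M, ← ENNReal.ofReal_natCast (N + 1), ← mul_assoc, ← mul_assoc,
            ← mul_assoc, ← ENNReal.ofReal_mul (Nat.cast_nonneg _),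
            ← ENNReal.ofReal_mul (by positivity), ← ENNReal.ofReal_mul (by positivity)]
          congr 1
          congr 1
          field_simp
  exact hgen.trans (liminf_le_of_frequently_le' (Frequently.of_forall hB))

/-! ### The quartic gain of one collision and its Gaussian flux moment -/

/-- **Per-collision gain bound.**  If the pair energy is conserved, `y₁² + y₂² = x₁² + x₂²`
(`x` = post-, `y` = pre-collisional speeds), then `(x₁⁴ + x₂⁴ − y₁⁴ − y₂⁴)₊/2 ≤ (x₁² + x₂²)²/4`
(`y₁⁴ + y₂⁴ ≥ (y₁² + y₂²)²/2` and `x₁⁴ + x₂⁴ ≤ (x₁² + x₂²)²`). [folklore] -/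
theorem quarticGain_le_of_sq_eq {x₁ x₂ y₁ y₂ : ℝ} (h : y₁ ^ 2 + y₂ ^ 2 = x₁ ^ 2 + x₂ ^ 2) :
    max (x₁ ^ 4 + x₂ ^ 4 - y₁ ^ 4 - y₂ ^ 4) 0 / 2 ≤ (x₁ ^ 2 + x₂ ^ 2) ^ 2 / 4 := by
  have h' : (y₁ ^ 2 + y₂ ^ 2) ^ 2 = (x₁ ^ 2 + x₂ ^ 2) ^ 2 := by rw [h]
  have h1 : x₁ ^ 4 + x₂ ^ 4 - y₁ ^ 4 - y₂ ^ 4 ≤ (x₁ ^ 2 + x₂ ^ 2) ^ 2 / 2 := by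
    nlinarith [sq_nonneg (y₁ ^ 2 - y₂ ^ 2), mul_nonneg (sq_nonneg x₁) (sq_nonneg x₂)]
  linarith [max_le h1 (by positivity : (0 : ℝ) ≤ (x₁ ^ 2 + x₂ ^ 2) ^ 2 / 2)]

/-- `(a + b)(a² + b²)²/4 ≤ a⁵ + b⁵` for `a, b ≥ 0`
(`4(a⁵ + b⁵) − (a + b)(a² + b²)² = 2(a − b)²(a + b)(a² + b²) + (a + b)(a² − b²)²`). [folklore] -/
theorem add_mul_sq_add_sq_sq_le {a b : ℝ} (ha : 0 ≤ a) (hb : 0 ≤ b) :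
    (a + b) * ((a ^ 2 + b ^ 2) ^ 2 / 4) ≤ a ^ 5 + b ^ 5 := by
  nlinarith [mul_nonneg (mul_nonneg (sq_nonneg (a - b)) (add_nonneg ha hb))
    (add_nonneg (sq_nonneg a) (sq_nonneg b)), mul_nonneg (add_nonneg ha hb) (sq_nonneg (a ^ 2 - b ^ 2))]

/-- **The flux-weighted Gaussian quartic moment is finite**:
`∫ ‖w − v‖ (‖v‖² + ‖w‖²)²/4 dN(u,θ)(v) dN(u,θ)(w) < ∞` (fifth Gaussian moments, Fernique). [folklore] -/
theorem lintegral_fluxQuartic_ne_top (u : V3) (θ : ℝ) :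
    ∫⁻ p, ENNReal.ofReal ‖p.2 - p.1‖ * ENNReal.ofReal ((‖p.1‖ ^ 2 + ‖p.2‖ ^ 2) ^ 2 / 4)
        ∂((gaussMeasure u θ).prod (gaussMeasure u θ)) ≠ ⊤ := by
  have h5 : Integrable (fun v : V3 => ‖v‖ ^ 5) (gaussMeasure u θ) := by
    have := (ProbabilityTheory.IsGaussian.memLp_id (gaussMeasure u θ) ((5 : ℕ) : ℝ≥0∞)
      (by simp)).integrable_norm_pow (by norm_num)
    simpa using this
  have hG : Integrable (fun p : V3 × V3 => ‖p.1‖ ^ 5 + ‖p.2‖ ^ 5)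
      ((gaussMeasure u θ).prod (gaussMeasure u θ)) :=
    (h5.comp_fst (gaussMeasure u θ)).add (h5.comp_snd (gaussMeasure u θ))
  refine ne_of_lt (lt_of_le_of_lt (lintegral_mono fun p => ?_) hG.lintegral_lt_top)
  rw [← ENNReal.ofReal_mul (norm_nonneg _)]
  refine ENNReal.ofReal_le_ofReal ?_
  have h1 : ‖p.2 - p.1‖ ≤ ‖p.1‖ + ‖p.2‖ := (norm_sub_le _ _).trans_eq (add_comm _ _)
  exact (mul_le_mul_of_nonneg_right h1 (by positivity)).trans
    (add_mul_sq_add_sq_sq_le (norm_nonneg _) (norm_nonneg _))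

/-! ### Pathwise: the window gain is a collision mark sum over the shifted window -/

/-- **Pathwise domination of the window gain.**  On a good orbit of a hard-sphere flow, for
`s′ ≤ s + h`, the quartic gain `Σ_{ordered collision records in (s, s′]} (Δ₄)₊/2` is at most the
collision pair sum of the energy mark `b(vᵢ, vⱼ) = (‖vᵢ‖² + ‖vⱼ‖²)²/4` (post-collisional velocities)
over `[0, h]` along the orbit of `Φ_s z` — `quarticGain_le_of_sq_eq`, window monotonicity
`(s, s′] ⊆ [s, s + h]`, and the group property (collision times shift by `s`). [folklore] -/
theorem ofReal_gainSum_le_collisionPairSum {d X : Type*} [Fintype d] [MeasureSpace X]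
    [TopologicalSpace X] {G : Geometry d X} {ε : ℝ} {n : ℕ} (Φ : HardSphereFlow G ε n)
    {z : Config n d X} (hz : z ∈ Φ.good) {s s' h : ℝ} (hs' : s' ≤ s + h) :
    ENNReal.ofReal (Φ.collisionSum (Ioc s s')
        (fun col => max (‖col.postVel.1‖ ^ 4 + ‖col.postVel.2‖ ^ 4
          - ‖col.preVel.1‖ ^ 4 - ‖col.preVel.2‖ ^ 4) 0 / 2) z) ≤
      Φ.collisionPairSum (Icc 0 h)
        (fun _ w i j => ENNReal.ofReal ((‖(w i).2‖ ^ 2 + ‖(w j).2‖ ^ 2) ^ 2 / 4)) (Φ.flow s z) := by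
  rw [HardSphereFlow.collisionSum_eq, collisionSum_eq_collisionPairSum]
  set γ : ℝ → Config n d X := fun r => Φ.flow r z with hγ
  have hγt : IsHardSphereTrajectory G ε n γ := Φ.isTrajectory z hz
  have hfin1 : (collisionTimes G ε γ ∩ Ioc s s').Finite :=
    hγt.finite_collisionTimes_inter_of_subset_Icc Ioc_subset_Icc_self
  have hfin2 : (collisionTimes G ε γ ∩ Icc s (s + h)).Finite := hγt.locFinite s (s + h)
  -- the energy mark along the orbit
  set m : ℝ → Fin n → Fin n → ℝ := fun t i j => (‖(γ t i).2‖ ^ 2 + ‖(γ t j).2‖ ^ 2) ^ 2 / 4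
    with hm
  have hm0 : ∀ t i j, 0 ≤ m t i j := fun t i j => by rw [hm]; positivity
  -- (1) per collision `(Δ₄)₊/2 ≤ b(v⁺, w⁺)`, (2) window monotonicity
  have h2 : collisionPairSum G ε γ (Ioc s s') m ≤ collisionPairSum G ε γ (Icc s (s + h)) m := by
    rw [collisionPairSum_eq_finset_sum hfin1, collisionPairSum_eq_finset_sum hfin2]
    refine Finset.sum_le_sum_of_subset_of_nonneg (fun t ht => ?_)
      (fun t _ _ => Finset.sum_nonneg fun p _ => hm0 t p.1 p.2)
    rw [Set.Finite.mem_toFinset] at ht ⊢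
    exact ⟨ht.1, (Ioc_subset_Icc_self.trans (Icc_subset_Icc_right hs')) ht.2⟩
  -- (3) `ofReal` of the finite sum
  have h3 : ENNReal.ofReal (collisionPairSum G ε γ (Icc s (s + h)) m) =
      collisionPairSum G ε γ (Icc s (s + h)) (fun t i j => ENNReal.ofReal (m t i j)) := by
    rw [collisionPairSum_eq_finset_sum hfin2, collisionPairSum_eq_finset_sum hfin2,
      ENNReal.ofReal_sum_of_nonneg fun t _ => Finset.sum_nonneg fun p _ => hm0 t p.1 p.2]
    exact Finset.sum_congr rfl fun t _ => ENNReal.ofReal_sum_of_nonneg fun p _ => hm0 t p.1 p.2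
  -- (4) the shift `Φ_r (Φ_s z) = Φ_{r+s} z`
  have hfa : ∀ r, Φ.flow r (Φ.flow s z) = γ (r + s) := fun r => (Φ.flow_add r s z hz).symm
  have h4 : collisionPairSum G ε γ (Icc s (s + h)) (fun t i j => ENNReal.ofReal (m t i j)) =
      Φ.collisionPairSum (Icc 0 h)
        (fun _ w i j => ENNReal.ofReal ((‖(w i).2‖ ^ 2 + ‖(w j).2‖ ^ 2) ^ 2 / 4)) (Φ.flow s z) := by
    unfold HardSphereFlow.collisionPairSum
    simp only [hfa]
    unfold collisionPairSum
    symm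
    refine finsum_mem_eq_of_bijOn (fun r => r + s) ⟨?_, ?_, ?_⟩ fun r _ => rfl
    · rintro r ⟨hr, h0, hrh⟩
      exact ⟨hr, by linarith, by linarith⟩
    · exact fun r _ r' _ hrr' => by simpa using hrr'
    · rintro t ⟨ht, hts, hth⟩
      refine ⟨t - s, ⟨?_, by linarith, by linarith⟩, sub_add_cancel t s⟩
      show t - s + s ∈ collisionTimes G ε γ
      rwa [sub_add_cancel]
  calc ENNReal.ofReal _ ≤ ENNReal.ofReal (collisionPairSum G ε γ (Icc s (s + h)) m) :=
        ENNReal.ofReal_le_ofReal ((collisionPairSum_mono hfin1 fun t _ p _ =>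
          quarticGain_le_of_sq_eq
            (HardSphereCollisionRecord.ofConfig_norm_sq_preVel G ε (γ t) t p.1 p.2)).trans h2)
    _ = _ := h3
    _ = _ := h4

/-! ### The certificate -/

/-- **Registered audit stub `stub_gainCeilingRung0` — the window gain ceiling at rung 0 (global
equilibrium), uniformly in `N` and in the window position.**  For constant profiles `a, θ̄ > 0` and any
constant drift `u` there is `σ₀ > 0` (the small reduced density of the Ruelle-type pair bound
`posGibbs_pairEvent_le`) such that for `0 < σ < σ₀`, every family of hard-sphere flows `Φ` and every
`τ > 0` there is `D ≥ 0` — explicitly `D = 16 τ σ² · ∫ ‖w − v‖ (‖v‖² + ‖w‖²)²/4 dN(u,θ̄)^{⊗2}` — with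
`∫ (N+1)⁻¹ Σ_{ordered collision records in (s,s′]} (Δ₄)₊/2 dG_N ≤ D` for all `N ≥ N₀ = 1` and ALL real
`s, s′` with `s′ ≤ s + τ (N+1)^{-1/3}` (`G_N = localGibbsLaw σ a u θ̄ N (Φ N)`): the conclusion of stub
S2 `stub_gainCeiling` at constant profiles with the slope-`η` term unused. [folklore] -/
theorem stub_gainCeilingRung0 : ∀ (a θb : ℝ) (u : V3), 0 < a → 0 < θb →
    ∃ σ₀ : ℝ, 0 < σ₀ ∧ ∀ σ : ℝ, 0 < σ → σ < σ₀ →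
      ∀ (Φ : (N : ℕ) → HardSphereFlow (Torus.geometry (Fin 3)) (hsDiameter σ N) (N + 1)) (τ : ℝ),
        0 < τ → ∃ D : ℝ, 0 ≤ D ∧ ∃ N₀ : ℕ, ∀ N : ℕ, N₀ ≤ N → ∀ s s' : ℝ,
          s' ≤ s + τ * ((N : ℝ) + 1) ^ (-(1 / 3 : ℝ)) →
            (∫⁻ z, ENNReal.ofReal (((N : ℝ) + 1)⁻¹ * (Φ N).collisionSum (Set.Ioc s s')
                (fun col => max (‖col.postVel.1‖ ^ 4 + ‖col.postVel.2‖ ^ 4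
                  - ‖col.preVel.1‖ ^ 4 - ‖col.preVel.2‖ ^ 4) 0 / 2) z)
              ∂(localGibbsLaw σ (fun _ => a) (fun _ => u) (fun _ => θb) N (Φ N))) ≤
              ENNReal.ofReal D := by
  intro a θb u ha hθ
  obtain ⟨σ₀, hσ₀, hsmall⟩ := exists_smallDensity uniformProfile one_pos
  refine ⟨σ₀, hσ₀, fun σ hσ hσlt Φ τ hτ => ?_⟩
  have hsm : SmallDensity uniformProfile σ := (hsmall σ hσ hσlt).1
  -- the mark and its Gaussian flux moment
  set A : V3 × V3 → ℝ≥0∞ := fun p => ENNReal.ofReal ((‖p.1‖ ^ 2 + ‖p.2‖ ^ 2) ^ 2 / 4) with hA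
  have hAm : Measurable A := by rw [hA]; fun_prop
  set I : ℝ≥0∞ := ∫⁻ p, ENNReal.ofReal ‖p.2 - p.1‖ * A p
    ∂((gaussMeasure u θb).prod (gaussMeasure u θb)) with hI
  have hItop : I ≠ ⊤ := lintegral_fluxQuartic_ne_top u θb
  set Ir : ℝ := I.toReal with hIr
  have hIr0 : 0 ≤ Ir := ENNReal.toReal_nonneg
  have hIeq : I = ENNReal.ofReal Ir := (ENNReal.ofReal_toReal hItop).symm
  refine ⟨16 * τ * σ ^ 2 * Ir, by positivity, 1, fun N hN s s' hs' => ?_⟩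
  set h : ℝ := τ * ((N : ℝ) + 1) ^ (-(1 / 3 : ℝ)) with hhdef
  have hh : 0 < h := by rw [hhdef]; positivity
  -- the expected collision mark sum over the shifted window
  have hflux := localGibbsLaw_lintegral_le_of_le_collisionMarkSum hsm.σ_lt_half.le ha hθ u (Φ N)
    (measurePreserving_flow_localGibbsLaw_const σ a θb u N (Φ N))
    (fun i j hij T hT => posGibbs_pairEvent_le hsm hN hij hT)
    (fun h hh => exists_sweptTube (hsDiameter_pos hσ N) hh)
    (fun S hS => by simpa only [sub_zero] using volume_setOf_exists_reprSym_add_latticeVec_mem_le 0 hS)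
    hh hAm s (fun z hz => ofReal_gainSum_le_collisionPairSum (Φ N) hz hs')
  -- the arithmetic of the constants: `(N+1)⁻¹ · 16 h (N+1)² ε² = 16 τ σ²`
  have hρ3 : ((N : ℝ) + 1) * (((N : ℝ) + 1) ^ (-(1 / 3 : ℝ))) ^ 3 = 1 := by
    rw [← Real.rpow_natCast (((N : ℝ) + 1) ^ (-(1 / 3 : ℝ))) 3, ← Real.rpow_mul (by positivity),
      show (-(1 / 3 : ℝ)) * ((3 : ℕ) : ℝ) = -1 by norm_num, Real.rpow_neg_one]
    field_simp
  have hgeom : ((N : ℝ) + 1)⁻¹ * (16 * h * ((N + 1 : ℕ) : ℝ) ^ 2 * hsDiameter σ N ^ 2) =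
      16 * τ * σ ^ 2 := by
    rw [hhdef, hsDiameter]
    push_cast
    have hn1 : (N : ℝ) + 1 ≠ 0 := by positivity
    calc _ = 16 * τ * σ ^ 2 * (((N : ℝ) + 1) * (((N : ℝ) + 1) ^ (-(1 / 3 : ℝ))) ^ 3) := by
          field_simp
      _ = 16 * τ * σ ^ 2 := by rw [hρ3, mul_one]
  have hc : (0 : ℝ) ≤ ((N : ℝ) + 1)⁻¹ := by positivity
  simp_rw [ENNReal.ofReal_mul hc]
  rw [lintegral_const_mul' _ _ ENNReal.ofReal_ne_top]
  calc ENNReal.ofReal ((N : ℝ) + 1)⁻¹ * _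
      ≤ ENNReal.ofReal ((N : ℝ) + 1)⁻¹ *
          (ENNReal.ofReal (16 * h * ((N + 1 : ℕ) : ℝ) ^ 2 * hsDiameter σ N ^ 2) * I) := by gcongr
    _ = ENNReal.ofReal (((N : ℝ) + 1)⁻¹ * (16 * h * ((N + 1 : ℕ) : ℝ) ^ 2 * hsDiameter σ N ^ 2) *
          Ir) := by
        rw [hIeq, ← mul_assoc, ← ENNReal.ofReal_mul hc, ← ENNReal.ofReal_mul (by positivity)]
    _ = ENNReal.ofReal (16 * τ * σ ^ 2 * Ir) := by rw [hgeom]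

end Summit.AtomisticToContinuum.HydrodynamicLimit.Theorems.QuarticSchurLedger

end
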